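import Summits.QuantumFields.YangMills.Theorems.InfiniteVolumeContinuumIVEuclideanInvarianceOn
import Summits.QuantumFields.YangMills.Theorems.InfiniteVolumeContinuumDataOnRP
import Summits.QuantumFields.YangMills.Theorems.BalabanLadderUVTorusClass
import Summits.QuantumFields.YangMills.Theorems.LangevinControlUVOSLegsFromFemtoAndGapStubAssemblyNontrivial
import HarnessLib

/-!
# Route `InfiniteVolumeContinuum` (target stmt-QuantumFields-19927): the target's DATA from floors, ceilings and the
# rotation Ward leg ON A TORUS CLASS — non-triviality ∕ non-Gaussianity for arbitrary data, and the class capstone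

Seat `ym-infvol-p1` (R136 (i)).  HONEST FRAMING: existence half only (OS0–OS3 + E0′ + NT∕NG of the
infinite-volume-first continuum data); `LowerBounds G r a`, `MomentBounds6 G r a` and the class-local rotation Ward
identities `Theorems.ROT.LatticeRotWardOn G r a S` are HYPOTHESES (the spine's legs NT∕UVSeamRec, UV∕UVSeamRec and
`ROT` rev 2′ — the last one guarded by the infrared leg `GapInUnits` in the route owner's R85 text); nothing about
Yang–Mills is asserted unconditionally; no clustering, no mass gap, not Clay.

WHY (route owner ym-beyond-p2 g21, `R85-BATCH-EDITS.md` rev 3e §5b; this seat's located memo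
`R85-ROT-IMPACT-infvol.md`, evidence #2 on 19927).  Under the planned restate of `BalabanLadder.ROT` to rev 2′
(`… → LowerBounds → MomentBounds6 → GapInUnits → ∃ S, UnboundedClass S ∧ LatticeRotWardOn G r a S`) the route's
6-binder `closes` breaks at the E1 step.  Seat p2's class package `exists_ivDataOn_onSides_rp`
(Theorems/InfiniteVolumeContinuumDataOnRP.lean) already delivers, for states chosen along the tori of ANY unbounded
raw-side class, the DATA clause with E0, hermiticity, E0′, E2, E3, translations and signed permutations — everything
except full E1 and NT∕NG.  THIS FILE adds the two missing pieces and packages the target's body: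

* §1 `exists_tail_torusDensity_tendsto` — for ANY data tuple whose states are odd-torus limit points: along a tail,
  torus sides `L_k ≥ a_k⁻²` with the spine's torus DENSITY functionals `latticeDist … tr F² … n` converging to `S₁ n`
  on `⁰𝒮` (junction `exists_torusSides_approximating` + `tendsto_base_of_tendsto_centre` + the toolkit identity
  `latticeDist_dens_eq_sum_latticeDistStr`; the block seat p2 ran inside `IVData_holds`, factored once).
* §2 **`nt_ng_of_data`** — the NT and NG conjuncts of the target for ANY such data tuple, from `LowerBounds G r a` via
  the spine's toolkit XI-b (`twoPointNontrivial_of_lowerBounds`, `nonGaussian_of_lowerBounds`): binder-agnostic, so it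
  serves today's `IVData` text and every class-local re-typing alike.
* §3 `exists_halfSides_of_oddClass` — raw sides `N k + 1 ∈ {2L+1 | L ∈ S}` ⇒ half-sides in `S` (p2's raw-side
  convention ↔ the rotation leg's half-side convention); `momentBounds6OnSides_oddClass` (the spine's `MomentBounds6`
  restricted to the odd raw sides over `S`, via osasm-p1's `momentBounds6OnSides_odd_iff` + `_mono`).
* §4 **`osExistenceData_of_latticeRotWardOn`** — THE CLASS CAPSTONE: from `a > 0`, `a → 0`, `LowerBounds G r a`,
  `MomentBounds6 G r a`, an unbounded half-side class `S` and `LatticeRotWardOn G r a S`, the body of the route's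
  target `OSExistenceFromInfiniteVolume` after `∃ r a` VERBATIM (states `μ k ∈ oddTorusLimitPoints r (β k)`, DATA,
  E0, hermitian, E0′, E1, E2, E3, translations, NT, NG) — p2's package on the class `{2L+1 | L ∈ S}` + this seat's
  `isEuclideanInvariant_of_latticeRotWardOn` + §2.  Under option (ii) of §5b the route's new `closes` is this theorem
  fed by the four legs; under option (iv) it is the E1-upgrade corollary (`Theorems/…OSExistenceOfLegsOn.lean`).

References: K. Osterwalder, R. Schrader, CMP 31 (1973), CMP 42 (1975); C. King, CMP 103 (1986) Thm 2.4;
J. Glimm, A. Jaffe, Quantum Physics (1987) §6.1; S. Chatterjee, arXiv:1803.01950 §2.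
-/

set_option autoImplicit false

noncomputable section

open MeasureTheory Filter Topology
open scoped BigOperators SchwartzMap
open Literature.MathematicalPhysics.QuantumFieldTheory hiding ZdEdge
open Literature.MathematicalPhysics.QuantumLattice
open Literature.MathematicalPhysics.AQFT
open Literature.Probability.LatticeModels (Site)
open Summit.QuantumFields.YangMills.Cruxes.OSLegsFromFemtoAndGap.DlrCollarTransfer
open Summit.QuantumFields.YangMills.Cruxes.OSLegsAtWeakCouplingC.Sketch (Invariant IsSignedPerm)
open Summit.QuantumFields.YangMills.Theorems.OSLegsFromFemtoAndGap
  (latticeDist latticeDistStr latticeDist_dens_eq_sum_latticeDistStr twoPointNontrivial_of_lowerBounds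
    nonGaussian_of_lowerBounds)
open Summit.QuantumFields.YangMills.Theorems.ROT (UnboundedClass LatticeRotWardOn)
open Summit.QuantumFields.YangMills.Cruxes.UV.TorusClass
  (MomentBounds6OnSides momentBounds6OnSides_odd_iff momentBounds6OnSides_mono)

namespace Summit.QuantumFields.YangMills.Theorems.InfiniteVolume

variable {G : Type} [Group G] [TopologicalSpace G] [IsTopologicalGroup G] [CompactSpace G]
  [MeasurableSpace G] [BorelSpace G]

/-! ## §1 Torus density functionals along a tail of the data -/

/-- **Torus approximation of the one-field family along a tail.**  For data `(β, μ, S₁, T)` in a positive unit `a → 0`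
carrying `MomentBounds6 G r a` — `β_k → ∞`, states `μ k ∈ oddTorusLimitPoints r (β k)`, `S₁ n = Σ_q T n q` (`n ≥ 2`)
and the centre-smeared DATA convergence — there are a tail index `k₁` and torus half-sides `L_k ≥ 14`,
`L_k ≥ a(β_{k+k₁})⁻²` such that the spine's torus density functionals `latticeDist r.ρ β_{k+k₁} L_k a(β_{k+k₁}) tr F² n`
converge to `S₁ n F` for every `n ≥ 2` and `F ∈ ⁰𝒮ₙ`. [folklore] -/
theorem exists_tail_torusDensity_tendsto (r : LatticeRep G) {a : ℝ → ℝ} (hapos : ∀ b, 0 < a b)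
    (ha0 : Tendsto a atTop (𝓝 0)) (hMB : MomentBounds6 G r a) (β : ℕ → ℝ) (μ : ℕ → Measure (LGConfig 4 G))
    (S₁ : SchwingerFamily (EuclideanSpace ℝ (Fin 4)))
    (T : (n : ℕ) → (Fin n → Fin 4 × Fin 4) → (𝓢((Fin n → EuclideanSpace ℝ (Fin 4)), ℂ) →L[ℂ] ℂ))
    (hβ : Tendsto β atTop atTop) (hμ : ∀ k, μ k ∈ oddTorusLimitPoints r (β k))
    (hS : ∀ n : ℕ, 2 ≤ n → ∀ F : 𝓢((Fin n → EuclideanSpace ℝ (Fin 4)), ℂ),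
      S₁ n F = ∑ q ∈ Fintype.piFinset (fun _ : Fin n => Finset.univ.filter fun p : Fin 4 × Fin 4 => p.1 < p.2), T n q F)
    (hT : ∀ n : ℕ, 2 ≤ n → ∀ q : Fin n → Fin 4 × Fin 4, (∀ i, (q i).1 < (q i).2) →
      ∀ F : 𝓢((Fin n → EuclideanSpace ℝ (Fin 4)), ℂ), IsOffDiagonal F →
        Tendsto (fun k => ∑' x : Fin n → (Fin 4 → ℤ), ((stateMomentStr G r (μ k) n q x : ℝ) : ℂ) *
          F (fun l => a (β k) • siteToE (x l) + (a (β k) / 2) •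
            (EuclideanSpace.single (q l).1 (1 : ℝ) + EuclideanSpace.single (q l).2 (1 : ℝ)))) atTop (𝓝 (T n q F))) :
    ∃ (k₁ : ℕ) (L : ℕ → ℕ), (∀ k, 14 ≤ L k ∧ (a (β (k + k₁)))⁻¹ * (a (β (k + k₁)))⁻¹ ≤ (L k : ℝ)) ∧
      ∀ n : ℕ, 2 ≤ n → ∀ F : 𝓢((Fin n → EuclideanSpace ℝ (Fin 4)), ℂ), IsOffDiagonal F →
        Tendsto (fun k => latticeDist r.ρ (β (k + k₁)) (L k) (a (β (k + k₁))) r.curvature.F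
          (wilsonTorusMean r.ρ (β (k + k₁)) (L k) r.curvature.F) n F) atTop (𝓝 (S₁ n F)) := by
  classical
  obtain ⟨β₀, ℓ₀, hℓ₀, HJ⟩ := exists_torusSides_approximating r hMB
  obtain ⟨k₁, hk₁⟩ : ∃ k₁ : ℕ, ∀ k, k₁ ≤ k → β₀ ≤ β k ∧ a (β k) ≤ 1 / 24 ∧ a (β k) ≤ ℓ₀ := by
    have e1 : ∀ᶠ k in atTop, β₀ ≤ β k := hβ.eventually_ge_atTop β₀
    have e2 : ∀ᶠ k in atTop, a (β k) ≤ 1 / 24 :=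
      (ha0.comp hβ).eventually (ge_mem_nhds (by norm_num : (0 : ℝ) < 1 / 24))
    have e3 : ∀ᶠ k in atTop, a (β k) ≤ ℓ₀ := (ha0.comp hβ).eventually (ge_mem_nhds hℓ₀)
    obtain ⟨k₁, hk₁⟩ := (e1.and (e2.and e3)).exists_forall_of_atTop
    exact ⟨k₁, hk₁⟩
  set β' : ℕ → ℝ := fun k => β (k + k₁) with hβ'def
  set μ' : ℕ → Measure (LGConfig 4 G) := fun k => μ (k + k₁) with hμ'def
  have hβ' : Tendsto β' atTop atTop := hβ.comp (tendsto_add_atTop_nat k₁)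
  have hμ' : ∀ k, μ' k ∈ oddTorusLimitPoints r (β' k) := fun k => hμ _
  have htail : ∀ k, β₀ ≤ β' k ∧ a (β' k) ≤ 1 / 24 ∧ a (β' k) ≤ ℓ₀ := fun k => hk₁ (k + k₁) (Nat.le_add_left _ _)
  obtain ⟨L, -, hL, -, hJ⟩ := HJ β' (fun k => (htail k).1) (fun k => hapos _) (fun k => (htail k).2.1)
    (fun k => (htail k).2.2) μ' hμ' (fun _ => 0)
  refine ⟨k₁, L, hL, fun n hn F hF => ?_⟩
  rw [hS n hn F]
  have hrw : (fun k => latticeDist r.ρ (β' k) (L k) (a (β' k)) r.curvature.F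
      (wilsonTorusMean r.ρ (β' k) (L k) r.curvature.F) n F) = fun k =>
      ∑ q ∈ Fintype.piFinset (fun _ : Fin n => Finset.univ.filter fun p : Fin 4 × Fin 4 => p.1 < p.2),
        latticeDistStr r.ρ (β' k) (L k) (a (β' k)) (fun i U => plaquetteObs r.ρ 0 (q i).1 (q i).2 U)
          (fun i => wilsonTorusMean r.ρ (β' k) (L k) (fun U => plaquetteObs r.ρ 0 (q i).1 (q i).2 U)) F :=
    funext fun k => latticeDist_dens_eq_sum_latticeDistStr r _ _ _ n F
  rw [hrw]
  refine tendsto_finsetSum _ fun q hq => ?_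
  have hqv : ∀ i, (q i).1 < (q i).2 := fun i => by
    rw [Fintype.mem_piFinset] at hq
    exact (Finset.mem_filter.1 (hq i)).2
  have hbase : Tendsto (fun k => ∑' x : Fin n → (Fin 4 → ℤ), ((stateMomentStr G r (μ' k) n q x : ℝ) : ℂ) *
      F (fun l => a (β' k) • siteToE (x l))) atTop (𝓝 (T n q F)) :=
    tendsto_base_of_tendsto_centre r hapos ha0 hMB β' hβ' μ' hμ' hn q hqv F hF
      ((hT n hn q hqv F hF).comp (tendsto_add_atTop_nat k₁))
  have hdiff := hJ n hn q hqv F hF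
  have hsum := hdiff.add hbase
  rw [zero_add] at hsum
  refine hsum.congr fun k => ?_
  simp only [stateMomentStr, hμ'def, hβ'def, sub_add_cancel]

/-! ## §2 Non-triviality and non-Gaussianity of arbitrary data from the floors -/

/-- **NT and NG of the infinite-volume-first continuum data from `LowerBounds`** — for ANY data tuple (states odd-torus
limit points, `S₁ 1 = 0`, `S₁ n = Σ_q T n q`, centre-smeared DATA convergence) in a positive unit `a → 0` carrying
`MomentBounds6 G r a`: the torus density functionals of §1 converge to `S₁` along tori with `a·L ≥ a⁻¹ → ∞`, so the
spine's toolkit XI-b turns the k-free lattice floors into the two OS non-triviality clauses. [folklore] -/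
theorem nt_ng_of_data (r : LatticeRep G) {a : ℝ → ℝ} (hapos : ∀ b, 0 < a b) (ha0 : Tendsto a atTop (𝓝 0))
    (hLB : LowerBounds G r a) (hMB : MomentBounds6 G r a) (β : ℕ → ℝ) (μ : ℕ → Measure (LGConfig 4 G))
    (S₁ : SchwingerFamily (EuclideanSpace ℝ (Fin 4)))
    (T : (n : ℕ) → (Fin n → Fin 4 × Fin 4) → (𝓢((Fin n → EuclideanSpace ℝ (Fin 4)), ℂ) →L[ℂ] ℂ))
    (hβ : Tendsto β atTop atTop) (hμ : ∀ k, μ k ∈ oddTorusLimitPoints r (β k))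
    (h1 : ∀ F : 𝓢((Fin 1 → EuclideanSpace ℝ (Fin 4)), ℂ), S₁ 1 F = 0)
    (hS : ∀ n : ℕ, 2 ≤ n → ∀ F : 𝓢((Fin n → EuclideanSpace ℝ (Fin 4)), ℂ),
      S₁ n F = ∑ q ∈ Fintype.piFinset (fun _ : Fin n => Finset.univ.filter fun p : Fin 4 × Fin 4 => p.1 < p.2), T n q F)
    (hT : ∀ n : ℕ, 2 ≤ n → ∀ q : Fin n → Fin 4 × Fin 4, (∀ i, (q i).1 < (q i).2) →
      ∀ F : 𝓢((Fin n → EuclideanSpace ℝ (Fin 4)), ℂ), IsOffDiagonal F →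
        Tendsto (fun k => ∑' x : Fin n → (Fin 4 → ℤ), ((stateMomentStr G r (μ k) n q x : ℝ) : ℂ) *
          F (fun l => a (β k) • siteToE (x l) + (a (β k) / 2) •
            (EuclideanSpace.single (q l).1 (1 : ℝ) + EuclideanSpace.single (q l).2 (1 : ℝ)))) atTop (𝓝 (T n q F))) :
    (∃ (F₁ G₁ : 𝓢((Fin 1 → EuclideanSpace ℝ (Fin 4)), ℂ)) (H₁ : 𝓢((Fin (1 + 1) → EuclideanSpace ℝ (Fin 4)), ℂ)),
      IsTimeOrdered F₁ ∧ IsTimeOrdered G₁ ∧ IsAppendTensorOf H₁ (osAdjoint F₁) G₁ ∧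
        S₁.toLabelled (1 + 1) (fun _ => ()) H₁ ≠
          S₁.toLabelled 1 (fun _ => ()) (osAdjoint F₁) * S₁.toLabelled 1 (fun _ => ()) G₁) ∧
    (∃ (f g h : 𝓢(EuclideanSpace ℝ (Fin 4), ℂ)) (Ffgh : 𝓢((Fin 3 → EuclideanSpace ℝ (Fin 4)), ℂ))
      (Fgh Ffh Ffg : 𝓢((Fin 2 → EuclideanSpace ℝ (Fin 4)), ℂ)) (Ff Fg Fh : 𝓢((Fin 1 → EuclideanSpace ℝ (Fin 4)), ℂ)),
      IsTensorOf Ffgh ![f, g, h] ∧ IsOffDiagonal Ffgh ∧ IsTensorOf Fgh ![g, h] ∧ IsTensorOf Ffh ![f, h] ∧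
      IsTensorOf Ffg ![f, g] ∧ IsTensorOf Ff ![f] ∧ IsTensorOf Fg ![g] ∧ IsTensorOf Fh ![h] ∧
        S₁.toLabelled 3 (fun _ => ()) Ffgh - S₁.toLabelled 1 (fun _ => ()) Ff * S₁.toLabelled 2 (fun _ => ()) Fgh -
          S₁.toLabelled 1 (fun _ => ()) Fg * S₁.toLabelled 2 (fun _ => ()) Ffh -
          S₁.toLabelled 1 (fun _ => ()) Fh * S₁.toLabelled 2 (fun _ => ()) Ffg +
          2 * (S₁.toLabelled 1 (fun _ => ()) Ff * S₁.toLabelled 1 (fun _ => ()) Fg *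
            S₁.toLabelled 1 (fun _ => ()) Fh) ≠ 0) := by
  obtain ⟨k₁, L, hL, hconv⟩ := exists_tail_torusDensity_tendsto r hapos ha0 hMB β μ S₁ T hβ hμ hS hT
  have hβ' : Tendsto (fun k => β (k + k₁)) atTop atTop := hβ.comp (tendsto_add_atTop_nat k₁)
  -- `a · L ≥ a⁻¹ → ∞`
  have haL : Tendsto (fun k => a (β (k + k₁)) * (L k : ℕ)) atTop atTop := by
    have hinv : Tendsto (fun k => (a (β (k + k₁)))⁻¹) atTop atTop :=
      tendsto_inv_nhdsGT_zero.comp (tendsto_nhdsWithin_iff.2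
        ⟨(ha0.comp hβ).comp (tendsto_add_atTop_nat k₁), Eventually.of_forall fun k => hapos _⟩)
    refine tendsto_atTop_mono (fun k => ?_) hinv
    have ha : 0 < a (β (k + k₁)) := hapos _
    calc (a (β (k + k₁)))⁻¹ = a (β (k + k₁)) * ((a (β (k + k₁)))⁻¹ * (a (β (k + k₁)))⁻¹) := by field_simp
      _ ≤ a (β (k + k₁)) * (L k : ℕ) := mul_le_mul_of_nonneg_left (hL k).2 ha.le
  exact ⟨twoPointNontrivial_of_lowerBounds r hLB.1 (fun k => β (k + k₁)) L hβ' haL S₁ h1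
      (fun F hF => hconv 2 le_rfl F hF),
    nonGaussian_of_lowerBounds r hLB.2 (fun k => β (k + k₁)) L hβ' haL S₁ h1
      (fun F hF => hconv 3 (by norm_num) F hF)⟩

/-! ## §3 Conventions: raw odd sides over a half-side class -/

/-- Raw sides `N k + 1` in the odd class `{2L+1 | L ∈ S}` along a strictly increasing `N` come from strictly increasing
HALF-sides in `S`: `N = 2·N'` with `N' k ∈ S`. [folklore] -/
theorem exists_halfSides_of_oddClass {S : Set ℕ} {N : ℕ → ℕ} (hN : StrictMono N)
    (hNS : ∀ k, N k + 1 ∈ {M : ℕ | ∃ L ∈ S, M = 2 * L + 1}) :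
    ∃ N' : ℕ → ℕ, StrictMono N' ∧ (∀ k, N' k ∈ S) ∧ (fun k => 2 * N' k) = N := by
  choose L hLS hL using hNS
  have hNL : ∀ k, N k = 2 * L k := fun k => by have := hL k; omega
  refine ⟨L, fun i j hij => ?_, hLS, funext fun k => (hNL k).symm⟩
  have := hN hij
  rw [hNL i, hNL j] at this
  omega

/-- The spine's `MomentBounds6 G r a` (all odd tori) gives the class-parametric ceilings on the odd raw sides over any
half-side class `S` (osasm-p1's `momentBounds6OnSides_odd_iff` and monotonicity in the class). [folklore] -/
theorem momentBounds6OnSides_oddClass (r : LatticeRep G) (a : ℝ → ℝ) (S : Set ℕ) (hMB : MomentBounds6 G r a) :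
    MomentBounds6OnSides G r a {M : ℕ | ∃ L ∈ S, M = 2 * L + 1} := by
  have hsub : {M : ℕ | ∃ L ∈ S, M = 2 * L + 1} ⊆ {M | Odd M} := by
    rintro M ⟨L, -, rfl⟩
    exact ⟨L, by ring⟩
  exact momentBounds6OnSides_mono r a hsub ((momentBounds6OnSides_odd_iff r a).2 hMB)

/-- An unbounded half-side class gives an unbounded class of odd raw sides. [folklore] -/
theorem oddClass_unbounded {S : Set ℕ} (hS : UnboundedClass S) :
    ∀ m : ℕ, ∃ M ∈ {M : ℕ | ∃ L ∈ S, M = 2 * L + 1}, m ≤ M := fun m => by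
  obtain ⟨L, hL, hmL⟩ := hS m
  exact ⟨2 * L + 1, ⟨L, hL, rfl⟩, by omega⟩

/-! ## §4 The class capstone: the target's data from floors, ceilings and the Ward leg on a class -/

/-- **THE TARGET'S DATA ON A CLASS.**  For every compact `G`, lattice representation `r` and positive unit `a → 0`
carrying the floors `LowerBounds G r a` and the ceilings `MomentBounds6 G r a`, every UNBOUNDED half-side class `S`
on which the rotation Ward identities `LatticeRotWardOn G r a S` hold: there are couplings `β_k → ∞`, infinite-volume
states `μ k ∈ oddTorusLimitPoints r (β k)` (chosen along ONE sequence of tori of the class), a one-field family `S₁`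
and plane-string limits `T` with the route's DATA clause, E0, hermiticity, E0′, FULL Euclidean invariance E1,
reflection positivity E2, symmetry E3, translation invariance on `⁰𝒮`, and the NT∕NG clauses — i.e. the body of
`Theses.InfiniteVolumeContinuum.OSExistenceFromInfiniteVolume` after `∃ r a`, verbatim.  Composition: seat p2's
`exists_ivDataOn_onSides_rp` on the odd class over `S` + `isEuclideanInvariant_of_latticeRotWardOn` + `nt_ng_of_data`.
[folklore] -/
theorem osExistenceData_of_latticeRotWardOn (r : LatticeRep G) {a : ℝ → ℝ} (hapos : ∀ b, 0 < a b)
    (ha0 : Tendsto a atTop (𝓝 0)) (hLB : LowerBounds G r a) (hMB : MomentBounds6 G r a) {S : Set ℕ}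
    (hSU : UnboundedClass S) (hW : LatticeRotWardOn G r a S) :
    ∃ (β : ℕ → ℝ) (μ : ℕ → Measure (LGConfig 4 G)) (S₁ : SchwingerFamily (EuclideanSpace ℝ (Fin 4))) (T : (n : ℕ) → (Fin n → Fin 4 × Fin 4) → (SchwartzMap (Fin n → EuclideanSpace ℝ (Fin 4)) ℂ →L[ℂ] ℂ)), (Filter.Tendsto β Filter.atTop Filter.atTop ∧ (∀ k, μ k ∈ oddTorusLimitPoints r (β k)) ∧ (∀ F : SchwartzMap (Fin 0 → EuclideanSpace ℝ (Fin 4)) ℂ, S₁ 0 F = F default) ∧ (∀ F : SchwartzMap (Fin 1 → EuclideanSpace ℝ (Fin 4)) ℂ, S₁ 1 F = 0) ∧ (∀ n : ℕ, 2 ≤ n → ∀ F : SchwartzMap (Fin n → EuclideanSpace ℝ (Fin 4)) ℂ, S₁ n F = ∑ q ∈ Fintype.piFinset (fun _ : Fin n => Finset.univ.filter fun p : Fin 4 × Fin 4 => p.1 < p.2), T n q F) ∧ (∀ n : ℕ, 2 ≤ n → ∀ q : Fin n → Fin 4 × Fin 4, (∀ i, (q i).1 < (q i).2) → ∀ F :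 SchwartzMap (Fin n → EuclideanSpace ℝ (Fin 4)) ℂ, IsOffDiagonal F → Filter.Tendsto (fun k => ∑' x : Fin n → (Fin 4 → ℤ), ((stateMomentStr G r (μ k) n q x : ℝ) : ℂ) * F (fun l => a (β k) • siteToE (x l) + (a (β k) / 2) • (EuclideanSpace.single (q l).1 (1 : ℝ) + EuclideanSpace.single (q l).2 (1 : ℝ)))) Filter.atTop (nhds (T n q F)))) ∧ S₁.toLabelled.IsNormalized ∧ S₁.toLabelled.IsHermitian ∧ S₁.toLabelled.HasLinearGrowth ∧ S₁.toLabelled.IsEuclideanInvariant ∧ S₁.toLabelled.IsReflectionPositive ∧ S₁.toLabelled.IsSymmetric ∧ (∀ (n : ℕ) (t : EuclideanSpace ℝ (Fin 4)) (F : SchwartzMap (Fin n → EuclideanSpace ℝ (Fin 4)) ℂ), IsOffDiagonal F → S₁ n (translateMulti t F) = S₁ n F) ∧ (∃ (F₁ G₁ : SchwartzMap (Fin 1 → EuclideanSpace ℝ (Fin 4)) ℂ) (H₁ : SchwartzMap (Fin (1 + 1) → EuclideanSpace ℝ (Fin 4)) ℂ), IsTimeOrdered F₁ ∧ IsTimeOrdered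 G₁ ∧ IsAppendTensorOf H₁ (osAdjoint F₁) G₁ ∧ S₁.toLabelled (1 + 1) (fun _ => ()) H₁ ≠ S₁.toLabelled 1 (fun _ => ()) (osAdjoint F₁) * S₁.toLabelled 1 (fun _ => ()) G₁) ∧ (∃ (f g h : SchwartzMap (EuclideanSpace ℝ (Fin 4)) ℂ) (Ffgh : SchwartzMap (Fin 3 → EuclideanSpace ℝ (Fin 4)) ℂ) (Fgh Ffh Ffg : SchwartzMap (Fin 2 → EuclideanSpace ℝ (Fin 4)) ℂ) (Ff Fg Fh : SchwartzMap (Fin 1 → EuclideanSpace ℝ (Fin 4)) ℂ), IsTensorOf Ffgh ![f, g, h] ∧ IsOffDiagonal Ffgh ∧ IsTensorOf Fgh ![g, h] ∧ IsTensorOf Ffh ![f, h] ∧ IsTensorOf Ffg ![f, g] ∧ IsTensorOf Ff ![f] ∧ IsTensorOf Fg ![g] ∧ IsTensorOf Fh ![h] ∧ S₁.toLabelled 3 (fun _ => ()) Ffgh - S₁.toLabelled 1 (fun _ => ()) Ff * S₁.toLabelled 2 (fun _ => ()) Fgh - S₁.toLabelled 1 (fun _ => ()) Fg * S₁.toLabelled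 2 (fun _ => ()) Ffh - S₁.toLabelled 1 (fun _ => ()) Fh * S₁.toLabelled 2 (fun _ => ()) Ffg + 2 * (S₁.toLabelled 1 (fun _ => ()) Ff * S₁.toLabelled 1 (fun _ => ()) Fg * S₁.toLabelled 1 (fun _ => ()) Fh) ≠ 0) := by
  classical
  -- p2's class package on the odd raw sides over `S`
  obtain ⟨β, N, μ, S₁, T, hβ, hN, hNS, hμN, h0, h1, hS, hT, hE0, hherm, hLG, hRP, hE2, hE3, htr, hsigned, -⟩ :=
    exists_ivDataOn_onSides_rp r hapos ha0 (momentBounds6OnSides_oddClass r a S hMB) (oddClass_unbounded hSU)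
  -- half-sides in `S`; the states are odd-torus limit points
  obtain ⟨N', hN', hN'S, hNN'⟩ := exists_halfSides_of_oddClass hN hNS
  have hμ' : ∀ k, IsInfiniteVolumeLimitAlong (d := 4) r.ρ (β k) (fun j => 2 * N' j) (μ k) := fun k => by
    rw [hNN']; exact hμN k
  have hμodd : ∀ k, μ k ∈ oddTorusLimitPoints r (β k) := fun k => ⟨N', hN', hμ' k⟩
  -- E1 on the class, NT∕NG from the floors
  have hE1 : S₁.toLabelled.IsEuclideanInvariant :=
    E1.isEuclideanInvariant_of_latticeRotWardOn r a S β μ (fun _ => N') S₁ T hapos ha0 hMB hW hβ (fun _ => hN')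
      (fun _ j => hN'S j) hμ' h0 h1 hS hT hLG htr hRP
  obtain ⟨hNT, hNG⟩ := nt_ng_of_data r hapos ha0 hLB hMB β μ S₁ T hβ hμodd h1 hS hT
  exact ⟨β, μ, S₁, T, ⟨hβ, hμodd, h0, h1, hS, hT⟩, hE0, hherm, hLG, hE1, hE2, hE3, htr, hNT, hNG⟩

end Summit.QuantumFields.YangMills.Theorems.InfiniteVolume

end
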